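import Mathlib
import Summits.KontsevichZagierPeriods.KontsevichZagierPeriods.Theorems.SoloInformedPellAbelLaw
import Summits.KontsevichZagierPeriods.KontsevichZagierPeriods.Theorems.SoloInformedDecidedHulls
import Summits.KontsevichZagierPeriods.KontsevichZagierPeriods.Theorems.SoloInformedKummerTorsionThreeKernel
import HarnessLib
import HarnessLib.Audit

/-!
# Kummer family VII: the order-three torsion law for the third kind, II — the law (s41)

COROLLARY XXIX.7 of the residency paper (§6quindecies), file II of two: the second instance of
THEOREM XXX (`SoloInformedPellAbelLaw`).  Along the rational curve of order-THREE torsion points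
`m(y) = (y²+1)³(3y²−1)/(16y⁶)`, `n(y) = (y²+1)(3y²−1)/(4y²)` (`1/3 < y² < 1`, `y` real algebraic;
`n = m·sn²(K/3 | m)`), the data of file I form a Pell–Abel datum (`soloInformedT3Datum`) with
constant `α(y) = 2/(3(1−y²))`, hence for ALL representations

  `⟦Π(n(y) | m(y))⟧ = 2/(3(1−y²))·⟦K(m(y))⟧` in `P`   (`soloInformed_kummer_torsionThree`),

e.g. `24·Π(17/225 | 4913/18225) = 25·K(4913/18225)` (`y = 3/5`).  Together with the order-two law
(`n = √m`, LEMMA XXIX.2, quadratic-irrational `n`) and the order-four law (COR XXIX.6) this exhibits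
the torsion packets of the Kummer family inside `P` without any transcendental input.

References: N. H. Abel (1826); M. Kontsevich, D. Zagier, *Periods* (2001), §1.2; this work.
-/

noncomputable section

open MeasureTheory Set Filter
open scoped Classical

open Literature.NumberTheory.Transcendental Literature.NumberTheory.Transcendental.KZ
open Literature.ModelTheory.ExponentialFields

namespace Summit.KontsevichZagierPeriods.KontsevichZagierPeriods.Theorems

/-! ### The order-three Pell–Abel datum -/

/-- **The order-three Pell–Abel datum** along `1/3 < y² < 1` (`y` algebraic). [this work] -/
def soloInformedT3Datum (y : ℝ) (hy : 1 < 3 * y ^ 2) (hy' : y ^ 2 < 1) (hya : IsAlgebraic ℚ y) :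
    SoloInformedPellAbel where
  m := soloInformedT3m y
  n := soloInformedT3n y
  q₀ := soloInformedT3q0 y
  q₂ := soloInformedT3q2 y
  A := soloInformedT3A y
  A' := fun t => -(soloInformedT3m y * (2 * t)) * (1 + soloInformedT3a y * t ^ 2) +
    (1 - soloInformedT3m y * t ^ 2) * (soloInformedT3a y * (2 * t))
  B := soloInformedT3B y
  B' := fun _ => soloInformedT3b y * 1
  R := fun t => (1 - soloInformedT3m y * t ^ 2) * (1 - soloInformedT3n y * t ^ 2) ^ 2
  m_mem := soloInformed_t3_m_mem hy hy'
  n_mem := soloInformed_t3_n_mem hy hy'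
  m_isAlgebraic := (soloInformed_t3_isAlgebraic hya).1
  n_isAlgebraic := (soloInformed_t3_isAlgebraic hya).2.1
  q₀_isAlgebraic := (soloInformed_t3_isAlgebraic hya).2.2.2.2.1
  q₂_isAlgebraic := (soloInformed_t3_isAlgebraic hya).2.2.2.2.2.1
  hasDerivAt_A := fun t => by
    show HasDerivAt (fun t => soloInformedT3A y t) _ t
    unfold soloInformedT3A
    exact (((soloInformed_hasDerivAt_sq t).const_mul _).const_sub 1).mul
      (((soloInformed_hasDerivAt_sq t).const_mul _).const_add 1)
  hasDerivAt_B := fun t => by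
    show HasDerivAt (fun t => soloInformedT3B y t) _ t
    unfold soloInformedT3B
    exact (hasDerivAt_id' t).const_mul _
  continuous_R := by fun_prop
  norm := fun t => by
    have hy0 : y ≠ 0 := by rintro rfl; norm_num at hy
    exact soloInformed_t3_norm hy0 t
  num := fun t => by
    have hy0 : y ≠ 0 := by rintro rfl; norm_num at hy
    have h := soloInformed_t3_numerator hy0 t
    linear_combination h
  A_pos := fun t ht => soloInformed_t3_A_pos hy hy' ht
  R_pos := fun t ht => soloInformed_t3_R_pos hy hy' ht
  B_zero := by simp [soloInformedT3B]
  res := soloInformed_t3_res hy hy'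
  sa_A := fun S hS i => (soloInformed_t3_sa hS hya i).1
  sa_B := fun S hS i => (soloInformed_t3_sa hS hya i).2.1
  sa_R := fun S hS i => (soloInformed_t3_sa hS hya i).2.2

/-- The datum's constant is `α(y) = 2/(3(1−y²))`. [this work] -/
theorem soloInformed_t3_datum_alpha {y : ℝ} (hy : 1 < 3 * y ^ 2) (hy' : y ^ 2 < 1)
    (hya : IsAlgebraic ℚ y) : (soloInformedT3Datum y hy hy' hya).alpha = soloInformedT3alpha y :=
  soloInformed_t3_alpha_eq hy hy'

/-! ### COROLLARY XXIX.7 -/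

/-- `α(y)` is algebraic for algebraic `y`. [folklore] -/
theorem soloInformed_t3_alpha_isAlgebraic {y : ℝ} (hya : IsAlgebraic ℚ y) :
    IsAlgebraic ℚ (soloInformedT3alpha y) :=
  (soloInformed_t3_isAlgebraic hya).2.2.2.2.2.2

/-- **COROLLARY XXIX.7 (order-three torsion law for the third kind).**  For real algebraic `y`
with `1 < 3y²`, `y² < 1`, and `m = m(y)`, `n = n(y)` as above: for ALL representations
`Π_n = [(0,1), κ_m/(1−nx²)]`, `K = [(0,1), κ_m]`, `⟦Π_n⟧ = ⟦[pt, 2/(3(1−y²))]⟧·⟦K⟧` in `P`.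
[this work] -/
theorem soloInformed_kummer_torsionThree (y : ℝ) (hy : 1 < 3 * y ^ 2) (hy' : y ^ 2 < 1)
    (hya : IsAlgebraic ℚ y) (PN K : IntegralRep 1)
    (hPNd : PN.domain = {x | x 0 ∈ Ioo (0:ℝ) 1})
    (hPNi : EqOn PN.integrand (fun x => (1 - soloInformedT3n y * x 0 ^ 2)⁻¹ *
      ((√(1 - x 0 ^ 2))⁻¹ * (√(1 - soloInformedT3m y * x 0 ^ 2))⁻¹)) PN.domain)
    (hKd : K.domain = {x | x 0 ∈ Ioo (0:ℝ) 1})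
    (hKi : EqOn K.integrand (fun x => (√(1 - x 0 ^ 2))⁻¹ * (√(1 - soloInformedT3m y * x 0 ^ 2))⁻¹)
      K.domain) :
    toFormalPeriod (of PN) =
      toFormalPeriod (of (IntegralRep.unit.constMul (soloInformedT3alpha y)
        (soloInformed_t3_alpha_isAlgebraic hya))) * toFormalPeriod (of K) := by
  have h := soloInformed_pellAbel_law (soloInformedT3Datum y hy hy' hya) PN K hPNd hPNi hKd hKi
  rw [h, soloInformed_pointRep_congr _ (soloInformed_t3_alpha_isAlgebraic hya)
    (soloInformed_t3_datum_alpha hy hy' hya)]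

/-- **COROLLARY XXIX.7 in values**: `Π(n(y) | m(y)) = 2K(m(y))/(3(1−y²))`. [this work] -/
theorem soloInformed_kummer_torsionThree_value (y : ℝ) (hy : 1 < 3 * y ^ 2) (hy' : y ^ 2 < 1)
    (hya : IsAlgebraic ℚ y) (PN K : IntegralRep 1)
    (hPNd : PN.domain = {x | x 0 ∈ Ioo (0:ℝ) 1})
    (hPNi : EqOn PN.integrand (fun x => (1 - soloInformedT3n y * x 0 ^ 2)⁻¹ *
      ((√(1 - x 0 ^ 2))⁻¹ * (√(1 - soloInformedT3m y * x 0 ^ 2))⁻¹)) PN.domain)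
    (hKd : K.domain = {x | x 0 ∈ Ioo (0:ℝ) 1})
    (hKi : EqOn K.integrand (fun x => (√(1 - x 0 ^ 2))⁻¹ * (√(1 - soloInformedT3m y * x 0 ^ 2))⁻¹)
      K.domain) :
    PN.value = soloInformedT3alpha y * K.value := by
  have h := congrArg evalP (soloInformed_kummer_torsionThree y hy hy' hya PN K hPNd hPNi hKd hKi)
  simpa only [map_mul, evalP_toFormalPeriod_of, IntegralRep.value_constMul,
    IntegralRep.value_unit, mul_one] using h

/-- **The two representations exist**, and satisfy the law. [this work] -/
theorem soloInformed_kummer_torsionThree_exists (y : ℝ) (hy : 1 < 3 * y ^ 2) (hy' : y ^ 2 < 1)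
    (hya : IsAlgebraic ℚ y) :
    ∃ PN K : IntegralRep 1,
      PN.domain = {x | x 0 ∈ Ioo (0:ℝ) 1} ∧
      (∀ x, PN.integrand x = (1 - soloInformedT3n y * x 0 ^ 2)⁻¹ *
        ((√(1 - x 0 ^ 2))⁻¹ * (√(1 - soloInformedT3m y * x 0 ^ 2))⁻¹)) ∧
      K.domain = {x | x 0 ∈ Ioo (0:ℝ) 1} ∧
      (∀ x, K.integrand x = (√(1 - x 0 ^ 2))⁻¹ * (√(1 - soloInformedT3m y * x 0 ^ 2))⁻¹) ∧
      PN.value = soloInformedT3alpha y * K.value := by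
  have hm := soloInformed_t3_m_mem hy hy'
  have hn := soloInformed_t3_n_mem hy hy'
  obtain ⟨hma, hna, -, -, -, -, -⟩ := soloInformed_t3_isAlgebraic hya
  obtain ⟨PN, hPNd, hPNi⟩ := soloInformed_exists_ellipticPi_rep_of_lt_one _ _ hn.2 hna hm hma
  obtain ⟨K, hKd, hKi⟩ := soloInformed_exists_ellipticK_rep _ hm hma
  exact ⟨PN, K, hPNd, hPNi, hKd, hKi, soloInformed_kummer_torsionThree_value y hy hy' hya PN K hPNd
    (fun x _ => hPNi x) hKd (fun x _ => hKi x)⟩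

/-- **The fibre `y = 3/5`**: `24·Π(17/225 | 4913/18225) = 25·K(4913/18225)` for all
representations. [this work] -/
theorem soloInformed_kummer_torsionThree_fibre (PN K : IntegralRep 1)
    (hPNd : PN.domain = {x | x 0 ∈ Ioo (0:ℝ) 1})
    (hPNi : EqOn PN.integrand (fun x => (1 - 17 / 225 * x 0 ^ 2)⁻¹ *
      ((√(1 - x 0 ^ 2))⁻¹ * (√(1 - 4913 / 18225 * x 0 ^ 2))⁻¹)) PN.domain)
    (hKd : K.domain = {x | x 0 ∈ Ioo (0:ℝ) 1})
    (hKi : EqOn K.integrand (fun x => (√(1 - x 0 ^ 2))⁻¹ * (√(1 - 4913 / 18225 * x 0 ^ 2))⁻¹)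
      K.domain) :
    24 * PN.value = 25 * K.value := by
  have hm : soloInformedT3m (3 / 5) = 4913 / 18225 := by norm_num [soloInformedT3m]
  have hn : soloInformedT3n (3 / 5) = 17 / 225 := by norm_num [soloInformedT3n]
  have hα : soloInformedT3alpha (3 / 5) = 25 / 24 := by norm_num [soloInformedT3alpha]
  have h35 : IsAlgebraic ℚ ((3 : ℝ) / 5) := by
    have h := isAlgebraic_algebraMap (R := ℚ) (A := ℝ) (3 / 5 : ℚ)
    simpa using h
  have h := soloInformed_kummer_torsionThree_value (3 / 5) (by norm_num) (by norm_num) h35 PN K hPNd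
    (by simp only [hm, hn]; exact hPNi) hKd (by simp only [hm]; exact hKi)
  rw [h, hα]
  ring

end Summit.KontsevichZagierPeriods.KontsevichZagierPeriods.Theorems

end
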